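import Summits.QuantumFields.YangMills.Theorems.BalabanUVNodesN15TwoSpacingGluingCutRows
import HarnessLib

/-!
# THE GLUING STEP AT TWO LATTICE SPACINGS — the input-localized remainder row with the NONLOCAL part SPLIT: `[N_L, M_h]∘N = N_L∘M_h∘(M_χ∘N) − M_h∘(M_χ∘N_L∘N)` (dag-n15-a g19, file N-IIj,
# a variant of dag-n15-c FILE 63 `hasMaj_commOp_comp_of_add_cut` whose one-sided hypothesis `hN1 : N ≤ 1_S(y′)β′e^{−δd}` the bare Neumann cube propagator cannot meet)

Cell `pub-ymgap`, seat `pub-ymgap-dag-n15-a` (KNIT-BY-NAME, g19; D-0062; chair R424 venue; `bears_on: R4∕N15`); `--kind proof --supports stmt-QuantumFields-20544 --as helper` — COUNT-NEUTRAL.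
One theorem added to dag-n15-c's namespace `…N15.Gluing`, in their vocabulary (`commOp`, `hasMaj_comp_exp_in`, `hasMaj_mulOp_comp_loc`); imports FILE 63 only.

WHY.  FILE 63's `hasMaj_commOp_comp_of_add_cut` composes the nonlocal commutator letter `[N_L, M_h] ≤ c_Ke^{−ρ₁d}` with a ONE-SIDED input-localized letter `N ≤ 1_S(y′)β′e^{−δd}` of the
cube operator.  For the Neumann cube propagator `N = G(□ + c) = Sym∘G∘M_{χ°}` (dag-n15-a N-IIIa) — the SYMMETRIC EXTENSION — no such letter holds with `β′` uniform in the cube size (its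
kernel has `2^{d+1}` bumps at the mirror images of the source block, N-IIf `hasMaj_neumannCubeG_images_of`).  The repair: split the commutator and use the partition's cut `M_h = M_h∘M_χ`
on BOTH halves — `N_L∘M_h∘(M_χ∘N)` reads the TWO-SIDED cut row of `N` (N-IIIb `hasMaj_chiCube_neumannCubeG`), `M_h∘(M_χ∘N_L∘N)` reads the OUTPUT-cut convolution row (N-IIi
`hasMaj_chiCube_comp_neumannCubeG`: behind an output cut the mirror images are farther).

WHAT.  ★★ `hasMaj_commOp_comp_of_add_cut_split`: `[Δ_loc + N_L, M_h]∘N ≤ 1_S(y′)·(θ₁ + c_Kβc_r + β₂)·e^{−ρd}` from the two-sided local row `θ₁`, `N_L ≤ c_Ke^{−ρ₁d}`, the two-sided cut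
row `M_χ∘N ≤ 1_S1_Sβe^{−δd}`, the output-cut convolution row `M_χ∘N_L∘N ≤ 1_S1_Sβ₂e^{−δd}`, `|h| ≤ 1` and `M_h∘M_χ = M_h` (`0 ≤ ρ ≤ δ`, `ρ + σ ≤ ρ₁`).
HONEST FRAMING.  Block-majorant bookkeeping ([B5] (1.121) p.37, (1.128) p.38; [B6] (2.134) p.247 = SHAPES); nothing of [B5]∕[B6]∕[B9] asserted; NE2⁺ NOT PRINTED; N15 NOT discharged;
counts UNMOVED (typed 28∕28 · discharged 5∕27); nothing continuum ∕ ℝ⁴ ∕ OS ∕ mass-gap ∕ Clay.  Theorems only (0 `def`).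
-/

noncomputable section

namespace Summit.QuantumFields.YangMills.BalabanUVNodes.N15.Gluing

open Literature.MathematicalPhysics.QuantumFieldTheory.Balaban1983to89
open Literature.MathematicalPhysics.QuantumFieldTheory.Balaban1983to89.B11SectG (BlockNorm HasMaj RowSum)
open Literature.MathematicalPhysics.QuantumFieldTheory.Balaban1983to89.B6RandomWalk (Triangle254)
open Literature.MathematicalPhysics.QuantumFieldTheory.Balaban1983to89.B6Prop26Gluing (mulOp ind ind_nonneg ind_le_one)

variable {X : Type} [Fintype X] {g : B6.Geometry} (blk : X → g.Site) {σ cr : ℝ}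

/-- ★★ **THE INPUT-LOCALIZED ROW OF `Δ_loc + N_L` WITH THE NONLOCAL COMMUTATOR SPLIT**: `[N_L, M_h]∘N = N_L∘M_h∘(M_χ∘N) − M_h∘(M_χ∘N_L∘N)` when `M_h∘M_χ = M_h`; hence from the two-sided
local row `θ₁`, `N_L ≤ c_Ke^{−ρ₁d}`, the two-sided cut row `M_χ∘N ≤ 1_S1_Sβe^{−δd}` and the output-cut convolution row `M_χ∘N_L∘N ≤ 1_S1_Sβ₂e^{−δd}`:
`[Δ_loc + N_L, M_h]∘N ≤ 1_S(y′)·(θ₁ + c_Kβc_r + β₂)·e^{−ρd}`. [cite: Balaban1984PropagatorsI, (1.121) p.37, (1.128) p.38 (mechanism); Balaban1984PropagatorsII, (2.134) p.247 (shape)] -/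
theorem hasMaj_commOp_comp_of_add_cut_split (htri : Triangle254 g) (hd : ∀ a b : g.Site, 0 ≤ g.dist a b) (hrow : RowSum g σ cr)
    {Δloc NL N : (X → ℝ) →ₗ[ℝ] (X → ℝ)} {h χ : X → ℝ} {S : Set g.Site} {θ₁ cK β β₂ δ ρ ρ₁ : ℝ}
    (hθ₁ : 0 ≤ θ₁) (hcK : 0 ≤ cK) (hβ : 0 ≤ β) (hβ₂ : 0 ≤ β₂) (hρ : 0 ≤ ρ) (hρδ : ρ ≤ δ) (hρ₁ : ρ + σ ≤ ρ₁)
    (hcut : mulOp h ∘ₗ mulOp χ = mulOp h) (hh : ∀ x, |h x| ≤ 1)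
    (hKloc : HasMaj (BlockNorm.ofBlocks g blk) (BlockNorm.ofBlocks g blk) (commOp Δloc h ∘ₗ N) (fun y y' => ind S y * ind S y' * (θ₁ * Real.exp (-(δ * g.dist y y')))))
    (hNL : HasMaj (BlockNorm.ofBlocks g blk) (BlockNorm.ofBlocks g blk) NL (fun y y' => cK * Real.exp (-(ρ₁ * g.dist y y'))))
    (hGc : HasMaj (BlockNorm.ofBlocks g blk) (BlockNorm.ofBlocks g blk) (mulOp χ ∘ₗ N) (fun y y' => ind S y * ind S y' * (β * Real.exp (-(δ * g.dist y y')))))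
    (hNc : HasMaj (BlockNorm.ofBlocks g blk) (BlockNorm.ofBlocks g blk) (mulOp χ ∘ₗ NL ∘ₗ N) (fun y y' => ind S y * ind S y' * (β₂ * Real.exp (-(δ * g.dist y y'))))) :
    HasMaj (BlockNorm.ofBlocks g blk) (BlockNorm.ofBlocks g blk) (commOp (Δloc + NL) h ∘ₗ N)
      (fun y y' => ind S y' * ((θ₁ + cK * β * cr + β₂) * Real.exp (-(ρ * g.dist y y')))) := by
  -- the split of the nonlocal commutator, cuts inserted behind `M_h`
  have hsplit : commOp (Δloc + NL) h ∘ₗ N =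
      commOp Δloc h ∘ₗ N + (NL ∘ₗ (mulOp h ∘ₗ (mulOp χ ∘ₗ N)) - mulOp h ∘ₗ (mulOp χ ∘ₗ NL ∘ₗ N)) := by
    rw [commOp_add_left, LinearMap.add_comp]
    congr 1
    rw [commOp, LinearMap.sub_comp, LinearMap.comp_assoc, LinearMap.comp_assoc, ← LinearMap.comp_assoc N (mulOp χ) (mulOp h), hcut,
      ← LinearMap.comp_assoc (NL ∘ₗ N) (mulOp χ) (mulOp h), hcut]
  -- the rows of the two halves
  have ta0 := hasMaj_mulOp_comp_loc blk zero_le_one hh hGc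
  have ta := hasMaj_comp_exp_in blk htri hd hrow hcK (by positivity : (0 : ℝ) ≤ 1 * β) hρ hρδ hρ₁ hNL ta0
  have tb := hasMaj_mulOp_comp_loc blk zero_le_one hh hNc
  rw [hsplit]
  refine (hKloc.add (ta.sub tb)).mono fun y y' => ?_
  have hexp : Real.exp (-(δ * g.dist y y')) ≤ Real.exp (-(ρ * g.dist y y')) := Real.exp_le_exp.2 (by nlinarith [hd y y'])
  have hiy : ind S y ≤ 1 := ind_le_one S y
  have hiy0 : 0 ≤ ind S y := ind_nonneg S y
  have hiy'0 : 0 ≤ ind S y' := ind_nonneg S y'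
  have hE0 : 0 ≤ Real.exp (-(ρ * g.dist y y')) := Real.exp_nonneg _
  -- two-sided rows weaken to one-sided ones at the slower rate
  have h1 : ind S y * ind S y' * (θ₁ * Real.exp (-(δ * g.dist y y'))) ≤ ind S y' * (θ₁ * Real.exp (-(ρ * g.dist y y'))) := by
    calc ind S y * ind S y' * (θ₁ * Real.exp (-(δ * g.dist y y'))) ≤ ind S y * ind S y' * (θ₁ * Real.exp (-(ρ * g.dist y y'))) :=
          mul_le_mul_of_nonneg_left (mul_le_mul_of_nonneg_left hexp hθ₁) (mul_nonneg hiy0 hiy'0)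
      _ ≤ 1 * ind S y' * (θ₁ * Real.exp (-(ρ * g.dist y y'))) :=
          mul_le_mul_of_nonneg_right (mul_le_mul_of_nonneg_right hiy hiy'0) (mul_nonneg hθ₁ hE0)
      _ = _ := by ring
  have h2 : ind S y * ind S y' * (1 * β₂ * Real.exp (-(δ * g.dist y y'))) ≤ ind S y' * (β₂ * Real.exp (-(ρ * g.dist y y'))) := by
    calc ind S y * ind S y' * (1 * β₂ * Real.exp (-(δ * g.dist y y'))) ≤ ind S y * ind S y' * (1 * β₂ * Real.exp (-(ρ * g.dist y y'))) :=
          mul_le_mul_of_nonneg_left (mul_le_mul_of_nonneg_left hexp (by positivity)) (mul_nonneg hiy0 hiy'0)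
      _ ≤ 1 * ind S y' * (1 * β₂ * Real.exp (-(ρ * g.dist y y'))) :=
          mul_le_mul_of_nonneg_right (mul_le_mul_of_nonneg_right hiy hiy'0) (by positivity)
      _ = _ := by ring
  calc ind S y * ind S y' * (θ₁ * Real.exp (-(δ * g.dist y y'))) +
        (ind S y' * (cK * (1 * β) * cr * Real.exp (-(ρ * g.dist y y'))) + ind S y * ind S y' * (1 * β₂ * Real.exp (-(δ * g.dist y y'))))
      ≤ ind S y' * (θ₁ * Real.exp (-(ρ * g.dist y y'))) +
        (ind S y' * (cK * (1 * β) * cr * Real.exp (-(ρ * g.dist y y'))) + ind S y' * (β₂ * Real.exp (-(ρ * g.dist y y')))) := by linarith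
    _ = _ := by ring

end Summit.QuantumFields.YangMills.BalabanUVNodes.N15.Gluing
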